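import Summits.QuantumFields.YangMills.Theorems.UnitScaleTiltProp7TrueLinIterStructure
import Summits.QuantumFields.YangMills.Theorems.UnitScaleTiltProp7CovHodgeSplit
import HarnessLib

/-!
# Route `UnitScaleTilt`, crux K1 «MinimiserStabilityRegPr» (stmt-QuantumFields-19200), line «route-R» (S2) — THE COVARIANT N7-A:
# THE TRUE CONSTRAINT READ ON THE COVARIANT HODGE PARTS, `G_k(B)(c) + P_{Ū₀^{(k)}}(Λ_k(B) − φ∘embIter k)(c) = (Q^{(k)}Y)(c)` for `Y = B + D_{U₀}φ`

Cell `ym3-torus`, D-0154 (3c) twin-width seat `ym-routeR-w1` (gen 0); `--supports stmt-QuantumFields-19200 --as helper`; THEOREMS ONLY (0 `def`, 0 `sorry`).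
YM₃ on T³ is a ladder rung (R3), not the Clay problem; nothing here claims the stub, the crux, d = 4 or the mass gap.

WHY.  The flat N7-A (✓ p598664 `Prop7PinnedConstraintSplit.constraint_on_hodge_parts`, source form ✓ p606158 `…_src`) reads the averaging constraint on a Hodge-split
field `Y = B + ∂φ`: the pure-gauge part passes through `Q^{(k)}` EXACTLY as the coarse gradient of `φ∘embIter k`, so the constraint becomes a statement about `B` and the
CENTRE VALUES of `φ` only.  At a curved background the two inputs are in the tree: (R-A) ✓ p606268 `Prop7TrueLinIterStructure.trueLinIter_structure`
(`Q k B = G_k(B) + P_{Ū₀^{(k)}}Λ_k(B)` for the recursion families `G`, `Λ` of ANY coarse-site maps `CM_j`) and brick 5 ✓ p605789 `Prop7TrueLinPureGaugeIter.trueLinIter_pureGauge`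
(`Q k (P_{U₀}ξ) = P_{Ū₀^{(k)}}(ξ∘embIter k)`), together with linearity `trueLinIter_sub`; and the covariant Hodge split ✓ p610574 `Prop7CovHodgeSplit.exists_covHodgeSplit(_T3)`
delivers `φ` with `D^*_{U₀}(Y − D_{U₀}φ) = 0`, where p483802's `D_{U₀}φ` is MINUS the pure-gauge letter `P_{U₀}φ` (`covD_bg_apply`).  This file is that algebra, by name.

WHAT IS PROVED (sorry-free, no definition; the one-step operator written out as in ✓ p606268; per-level (0.4) guards `dist1(W^{(j)}_i(c)) < δ_N`, `j < k`):
* §1 ★★ `covConstraint_on_hodge_parts` — for `Y = B − P_{U₀}φ` bond-wise and the recursion families `G`, `Λ` of `B`: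
  `G k c + ((Λ k c₋ − φ(embIter k c₋)) − Ū₀^{(k)}(c)·(Λ k c₊ − φ(embIter k c₊))·Ū₀^{(k)}(c)*) = Q k Y c` for every `k`-bond `c`;
  ★ `norm_reduced_le_of_hodge_parts` — `‖G k c‖ ≤ ‖Q k Y c‖ + ‖Λ k c₋ − φ(embIter k c₋)‖ + ‖Λ k c₊ − φ(embIter k c₊)‖` (unitary transport).
* §2 `covD_bg_apply` — `(D_{U₀}φ)(b) = U₀(b)·φ(b₊)·U₀(b)* − φ(b₋) = −(P_{U₀}φ)(b)` in p483802's letters `covD (torusT) (unitsField (toUField U₀))`;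
  ★ `covConstraint_on_hodge_parts_covD` — §1 with the hypothesis in the Hodge-split form `Y b = B b + (D_{U₀}φ)(b)` (the output of `exists_covHodgeSplit_T3`).

HONEST SCOPE.  Identities and the triangle inequality; `CM_j`, `G`, `Λ` abstract by their recursions exactly as in ✓ p606268; the analytic rows (R-B) `(H¹)^*`-bound of `Λ`,
(R-C) `G_k` vs the engine's straight-line functional, and the size of `φ` (memo `N8-PACKAGE-MEMO-routeRw1g0.md` §3) are NOT here.

References: T. Bałaban, CMP 95 (1984) 17–40 [Balaban1984PropagatorsI] ((1.18)–(1.20) pp.19–20); CMP 98 (1985) 17–51 [Balaban1985Averaging] ((11) p.19, (124)–(125) p.36);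
CMP 99 (1985) 389–434 [Balaban1985BackgroundPropagators] ((3.3) p.390); CMP 102 (1985) 277–309 [Balaban1985Variational] (Prop. 7 p.299).
-/

set_option autoImplicit false

noncomputable section

open scoped BigOperators Matrix.Norms.L2Operator Matrix

namespace Summit.QuantumFields.YangMills.Theorems.Prop7CovHodgeConstraint

open Literature.MathematicalPhysics.QuantumFieldTheory.Balaban1983to89
open Finset T4Continuum BlockAveraging AveragingRT ExpMeanLog BlockAveragingEMLLinearised BlockAveragingEMLLinearisedBackground BlockAveragingEMLProp2
open B15DeterminingSets (embIter)
open Summit.QuantumFields.YangMills.Theorems.Prop7TrueLinIterStructure (trueLinIter_structure norm_pureGauge_le)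
open Summit.QuantumFields.YangMills.Theorems.Prop7TrueLinPureGaugeIter (trueLinIter_pureGauge trueLinIter_sub)

variable {P : Params} {n : Type*} [Fintype n] [DecidableEq n] [Nonempty n]

/-! ## §1 The constraint on the covariant Hodge parts -/

/-- ★★ **THE TRUE CONSTRAINT READ ON THE COVARIANT HODGE PARTS.**  Background tower `Ū₀^{(j)} = Averaging.iter (blockAvg ℰp) j U₀`; `Q` any composite of the true one-step
linearisations along it (`hQ0`, `hQs`); `Y = B − P_{U₀}φ` bond-wise (`P_{U₀}φ(b) = φ(b₋) − U₀(b)φ(b₊)U₀(b)*`, i.e. `Y = B + D_{U₀}φ`); `G`, `Λ` the recursion families of `B` for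
ANY coarse-site maps `CM_j` (as in `trueLinIter_structure`).  Then under the per-level (0.4) guards, for every `k`-bond `c`,
`G k c + ((Λ k c₋ − φ(embIter k c₋)) − Ū₀^{(k)}(c)·(Λ k c₊ − φ(embIter k c₊))·Ū₀^{(k)}(c)*) = Q k Y c`.
[cite: Balaban1984PropagatorsI, (1.18)-(1.20) pp.19-20; Balaban1985Averaging, (11) p.19, (124) p.36] -/
theorem covConstraint_on_hodge_parts (U₀ : GaugeField P 0 (Matrix.specialUnitaryGroup n ℂ))
    (Q : (k : ℕ) → (PBond P 0 → Matrix n n ℂ) → PBond P k → Matrix n n ℂ) (hQ0 : ∀ Y, Q 0 Y = Y)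
    (hQs : ∀ (k : ℕ) (Y : PBond P 0 → Matrix n n ℂ) (c : PBond P (k + 1)), Q (k + 1) Y c
      = fderiv ℂ (eml : (Idx P → Matrix n n ℂ) → Matrix n n ℂ)
            (fun i => ((loopHol (Averaging.iter (fun i => blockAvg (P := P) (j := i) (expMeanLogSU (n := n))) k U₀) c i :
              Matrix.specialUnitaryGroup n ℂ) : Matrix n n ℂ))
            (fun i => covWalkSum (Averaging.iter (fun i => blockAvg (P := P) (j := i) (expMeanLogSU (n := n))) k U₀) (Q k Y)
                (walk (emb c.src) (loopWord P.L c.dir (off i.1) i.2.1 i.2.2))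
              * ((loopHol (Averaging.iter (fun i => blockAvg (P := P) (j := i) (expMeanLogSU (n := n))) k U₀) c i :
                Matrix.specialUnitaryGroup n ℂ) : Matrix n n ℂ))
            * star ((corr (expMeanLogSU (n := n)) (Averaging.iter (fun i => blockAvg (P := P) (j := i) (expMeanLogSU (n := n))) k U₀) c :
                Matrix.specialUnitaryGroup n ℂ) : Matrix n n ℂ)
          + ((corr (expMeanLogSU (n := n)) (Averaging.iter (fun i => blockAvg (P := P) (j := i) (expMeanLogSU (n := n))) k U₀) c :
                Matrix.specialUnitaryGroup n ℂ) : Matrix n n ℂ)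
            * covWalkSum (Averaging.iter (fun i => blockAvg (P := P) (j := i) (expMeanLogSU (n := n))) k U₀) (Q k Y)
                (walk (emb c.src) (List.replicate P.L (c.dir, true)))
            * star ((corr (expMeanLogSU (n := n)) (Averaging.iter (fun i => blockAvg (P := P) (j := i) (expMeanLogSU (n := n))) k U₀) c :
                Matrix.specialUnitaryGroup n ℂ) : Matrix n n ℂ))
    (Y B : PBond P 0 → Matrix n n ℂ) (φ : Site P 0 → Matrix n n ℂ)
    (hY : ∀ b : PBond P 0, Y b = B b - (φ b.src - ((U₀ b : Matrix.specialUnitaryGroup n ℂ) : Matrix n n ℂ) * φ b.tgt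
        * star ((U₀ b : Matrix.specialUnitaryGroup n ℂ) : Matrix n n ℂ)))
    (CM : (k : ℕ) → (PBond P k → Matrix n n ℂ) → Site P (k + 1) → Matrix n n ℂ)
    (G : (k : ℕ) → PBond P k → Matrix n n ℂ) (Λ : (k : ℕ) → Site P k → Matrix n n ℂ)
    (hG0 : ∀ b, G 0 b = B b) (hΛ0 : ∀ x, Λ 0 x = 0)
    (hΛs : ∀ (k : ℕ) (z : Site P (k + 1)), Λ (k + 1) z = CM k (G k) z + Λ k (emb z))
    (hGs : ∀ (k : ℕ) (c : PBond P (k + 1)), G (k + 1) c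
      = (fderiv ℂ (eml : (Idx P → Matrix n n ℂ) → Matrix n n ℂ)
            (fun i => ((loopHol (Averaging.iter (fun i => blockAvg (P := P) (j := i) (expMeanLogSU (n := n))) k U₀) c i :
              Matrix.specialUnitaryGroup n ℂ) : Matrix n n ℂ))
            (fun i => covWalkSum (Averaging.iter (fun i => blockAvg (P := P) (j := i) (expMeanLogSU (n := n))) k U₀) (G k)
                (walk (emb c.src) (loopWord P.L c.dir (off i.1) i.2.1 i.2.2))
              * ((loopHol (Averaging.iter (fun i => blockAvg (P := P) (j := i) (expMeanLogSU (n := n))) k U₀) c i :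
                Matrix.specialUnitaryGroup n ℂ) : Matrix n n ℂ))
            * star ((corr (expMeanLogSU (n := n)) (Averaging.iter (fun i => blockAvg (P := P) (j := i) (expMeanLogSU (n := n))) k U₀) c :
                Matrix.specialUnitaryGroup n ℂ) : Matrix n n ℂ)
          + ((corr (expMeanLogSU (n := n)) (Averaging.iter (fun i => blockAvg (P := P) (j := i) (expMeanLogSU (n := n))) k U₀) c :
                Matrix.specialUnitaryGroup n ℂ) : Matrix n n ℂ)
            * covWalkSum (Averaging.iter (fun i => blockAvg (P := P) (j := i) (expMeanLogSU (n := n))) k U₀) (G k)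
                (walk (emb c.src) (List.replicate P.L (c.dir, true)))
            * star ((corr (expMeanLogSU (n := n)) (Averaging.iter (fun i => blockAvg (P := P) (j := i) (expMeanLogSU (n := n))) k U₀) c :
                Matrix.specialUnitaryGroup n ℂ) : Matrix n n ℂ))
        - (CM k (G k) c.src
            - ((Averaging.iter (fun i => blockAvg (P := P) (j := i) (expMeanLogSU (n := n))) (k + 1) U₀ c : Matrix.specialUnitaryGroup n ℂ) :
                Matrix n n ℂ) * CM k (G k) c.tgt
              * star ((Averaging.iter (fun i => blockAvg (P := P) (j := i) (expMeanLogSU (n := n))) (k + 1) U₀ c :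
                Matrix.specialUnitaryGroup n ℂ) : Matrix n n ℂ))) :
    ∀ k : ℕ, (∀ j < k, ∀ (c : PBond P (j + 1)) (i : Idx P),
        dist1 (loopHol (Averaging.iter (fun i => blockAvg (P := P) (j := i) (expMeanLogSU (n := n))) j U₀) c i) < deltaSU n) →
      ∀ c : PBond P k,
        G k c + ((Λ k c.src - φ (embIter k c.src))
            - ((Averaging.iter (fun i => blockAvg (P := P) (j := i) (expMeanLogSU (n := n))) k U₀ c : Matrix.specialUnitaryGroup n ℂ) : Matrix n n ℂ)
              * (Λ k c.tgt - φ (embIter k c.tgt))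
              * star ((Averaging.iter (fun i => blockAvg (P := P) (j := i) (expMeanLogSU (n := n))) k U₀ c : Matrix.specialUnitaryGroup n ℂ) :
                  Matrix n n ℂ))
          = Q k Y c := by
  intro k hg c
  -- `Y = B − P_{U₀}φ` as functions
  have hYf : Y = B - (fun b : PBond P 0 => φ b.src - ((U₀ b : Matrix.specialUnitaryGroup n ℂ) : Matrix n n ℂ) * φ b.tgt
      * star ((U₀ b : Matrix.specialUnitaryGroup n ℂ) : Matrix n n ℂ)) := funext fun b => by rw [Pi.sub_apply]; exact hY b
  rw [hYf, trueLinIter_sub U₀ Q hQ0 hQs k, trueLinIter_structure U₀ Q hQ0 hQs B CM G Λ hG0 hΛ0 hΛs hGs k hg c,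
    trueLinIter_pureGauge U₀ Q hQ0 hQs φ k hg c]
  noncomm_ring

/-- ★ **THE REDUCED PART AGAINST THE CONSTRAINT VALUE AND THE COARSE DATA `Λ − φ∘embIter`**: `‖G k c‖ ≤ ‖Q k Y c‖ + ‖Λ k c₋ − φ(embIter k c₋)‖ + ‖Λ k c₊ − φ(embIter k c₊)‖`
(the transport by `Ū₀^{(k)}(c)` is an isometry). [cite: Balaban1985Variational, Prop. 7 p.299; Balaban1985Averaging, (11) p.19] -/
theorem norm_reduced_le_of_hodge_parts (U₀ : GaugeField P 0 (Matrix.specialUnitaryGroup n ℂ))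
    (Q : (k : ℕ) → (PBond P 0 → Matrix n n ℂ) → PBond P k → Matrix n n ℂ) (hQ0 : ∀ Y, Q 0 Y = Y)
    (hQs : ∀ (k : ℕ) (Y : PBond P 0 → Matrix n n ℂ) (c : PBond P (k + 1)), Q (k + 1) Y c
      = fderiv ℂ (eml : (Idx P → Matrix n n ℂ) → Matrix n n ℂ)
            (fun i => ((loopHol (Averaging.iter (fun i => blockAvg (P := P) (j := i) (expMeanLogSU (n := n))) k U₀) c i :
              Matrix.specialUnitaryGroup n ℂ) : Matrix n n ℂ))
            (fun i => covWalkSum (Averaging.iter (fun i => blockAvg (P := P) (j := i) (expMeanLogSU (n := n))) k U₀) (Q k Y)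
                (walk (emb c.src) (loopWord P.L c.dir (off i.1) i.2.1 i.2.2))
              * ((loopHol (Averaging.iter (fun i => blockAvg (P := P) (j := i) (expMeanLogSU (n := n))) k U₀) c i :
                Matrix.specialUnitaryGroup n ℂ) : Matrix n n ℂ))
            * star ((corr (expMeanLogSU (n := n)) (Averaging.iter (fun i => blockAvg (P := P) (j := i) (expMeanLogSU (n := n))) k U₀) c :
                Matrix.specialUnitaryGroup n ℂ) : Matrix n n ℂ)
          + ((corr (expMeanLogSU (n := n)) (Averaging.iter (fun i => blockAvg (P := P) (j := i) (expMeanLogSU (n := n))) k U₀) c :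
                Matrix.specialUnitaryGroup n ℂ) : Matrix n n ℂ)
            * covWalkSum (Averaging.iter (fun i => blockAvg (P := P) (j := i) (expMeanLogSU (n := n))) k U₀) (Q k Y)
                (walk (emb c.src) (List.replicate P.L (c.dir, true)))
            * star ((corr (expMeanLogSU (n := n)) (Averaging.iter (fun i => blockAvg (P := P) (j := i) (expMeanLogSU (n := n))) k U₀) c :
                Matrix.specialUnitaryGroup n ℂ) : Matrix n n ℂ))
    (Y B : PBond P 0 → Matrix n n ℂ) (φ : Site P 0 → Matrix n n ℂ)
    (hY : ∀ b : PBond P 0, Y b = B b - (φ b.src - ((U₀ b : Matrix.specialUnitaryGroup n ℂ) : Matrix n n ℂ) * φ b.tgt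
        * star ((U₀ b : Matrix.specialUnitaryGroup n ℂ) : Matrix n n ℂ)))
    (CM : (k : ℕ) → (PBond P k → Matrix n n ℂ) → Site P (k + 1) → Matrix n n ℂ)
    (G : (k : ℕ) → PBond P k → Matrix n n ℂ) (Λ : (k : ℕ) → Site P k → Matrix n n ℂ)
    (hG0 : ∀ b, G 0 b = B b) (hΛ0 : ∀ x, Λ 0 x = 0)
    (hΛs : ∀ (k : ℕ) (z : Site P (k + 1)), Λ (k + 1) z = CM k (G k) z + Λ k (emb z))
    (hGs : ∀ (k : ℕ) (c : PBond P (k + 1)), G (k + 1) c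
      = (fderiv ℂ (eml : (Idx P → Matrix n n ℂ) → Matrix n n ℂ)
            (fun i => ((loopHol (Averaging.iter (fun i => blockAvg (P := P) (j := i) (expMeanLogSU (n := n))) k U₀) c i :
              Matrix.specialUnitaryGroup n ℂ) : Matrix n n ℂ))
            (fun i => covWalkSum (Averaging.iter (fun i => blockAvg (P := P) (j := i) (expMeanLogSU (n := n))) k U₀) (G k)
                (walk (emb c.src) (loopWord P.L c.dir (off i.1) i.2.1 i.2.2))
              * ((loopHol (Averaging.iter (fun i => blockAvg (P := P) (j := i) (expMeanLogSU (n := n))) k U₀) c i :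
                Matrix.specialUnitaryGroup n ℂ) : Matrix n n ℂ))
            * star ((corr (expMeanLogSU (n := n)) (Averaging.iter (fun i => blockAvg (P := P) (j := i) (expMeanLogSU (n := n))) k U₀) c :
                Matrix.specialUnitaryGroup n ℂ) : Matrix n n ℂ)
          + ((corr (expMeanLogSU (n := n)) (Averaging.iter (fun i => blockAvg (P := P) (j := i) (expMeanLogSU (n := n))) k U₀) c :
                Matrix.specialUnitaryGroup n ℂ) : Matrix n n ℂ)
            * covWalkSum (Averaging.iter (fun i => blockAvg (P := P) (j := i) (expMeanLogSU (n := n))) k U₀) (G k)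
                (walk (emb c.src) (List.replicate P.L (c.dir, true)))
            * star ((corr (expMeanLogSU (n := n)) (Averaging.iter (fun i => blockAvg (P := P) (j := i) (expMeanLogSU (n := n))) k U₀) c :
                Matrix.specialUnitaryGroup n ℂ) : Matrix n n ℂ))
        - (CM k (G k) c.src
            - ((Averaging.iter (fun i => blockAvg (P := P) (j := i) (expMeanLogSU (n := n))) (k + 1) U₀ c : Matrix.specialUnitaryGroup n ℂ) :
                Matrix n n ℂ) * CM k (G k) c.tgt
              * star ((Averaging.iter (fun i => blockAvg (P := P) (j := i) (expMeanLogSU (n := n))) (k + 1) U₀ c :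
                Matrix.specialUnitaryGroup n ℂ) : Matrix n n ℂ)))
    {k : ℕ} (hg : ∀ j < k, ∀ (c : PBond P (j + 1)) (i : Idx P),
        dist1 (loopHol (Averaging.iter (fun i => blockAvg (P := P) (j := i) (expMeanLogSU (n := n))) j U₀) c i) < deltaSU n)
    (c : PBond P k) :
    ‖G k c‖ ≤ ‖Q k Y c‖ + ‖Λ k c.src - φ (embIter k c.src)‖ + ‖Λ k c.tgt - φ (embIter k c.tgt)‖ := by
  have h := covConstraint_on_hodge_parts U₀ Q hQ0 hQs Y B φ hY CM G Λ hG0 hΛ0 hΛs hGs k hg c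
  have hP := norm_pureGauge_le (Averaging.iter (fun i => blockAvg (P := P) (j := i) (expMeanLogSU (n := n))) k U₀)
    (fun y : Site P k => Λ k y - φ (embIter k y)) c
  have hG : G k c = Q k Y c - ((Λ k c.src - φ (embIter k c.src))
      - ((Averaging.iter (fun i => blockAvg (P := P) (j := i) (expMeanLogSU (n := n))) k U₀ c : Matrix.specialUnitaryGroup n ℂ) : Matrix n n ℂ)
        * (Λ k c.tgt - φ (embIter k c.tgt))
        * star ((Averaging.iter (fun i => blockAvg (P := P) (j := i) (expMeanLogSU (n := n))) k U₀ c : Matrix.specialUnitaryGroup n ℂ) :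
            Matrix n n ℂ)) := by
    rw [← h]; abel
  rw [hG]
  refine (norm_sub_le _ _).trans ?_
  have := hP
  simp only [PBond.tgt] at this ⊢
  linarith

/-! ## §2 The same in p483802's letters: `D_{U₀}φ = −P_{U₀}φ`, and the Hodge-split form of the hypothesis -/

section Units

variable {N : ℕ}

/-- **`(D_{U₀}φ)(b) = U₀(b)·φ(b₊)·U₀(b)* − φ(b₋)`** for the background read through `unitsField ∘ toUField` (so `D_{U₀}φ = −P_{U₀}φ`).
[cite: Balaban1985BackgroundPropagators, (3.3) p.390] -/
theorem covD_bg_apply {j : ℕ} (U₀ : GaugeField P j (Matrix.specialUnitaryGroup (Fin N) ℂ)) (φ : Site P j → Matrix (Fin N) (Fin N) ℂ) (b : PBond P j) :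
    B9Eq39Adjoint.covD (B9TorusCalculus.torusT P j) (fun κ z => B10Eq27TorusAxialLog.unitsField (B10Eq27TorusAxialLog.toUField U₀) ⟨z, κ⟩) b.dir φ b.src
      = ((U₀ b : Matrix.specialUnitaryGroup (Fin N) ℂ) : Matrix (Fin N) (Fin N) ℂ) * φ b.tgt
          * star ((U₀ b : Matrix.specialUnitaryGroup (Fin N) ℂ) : Matrix (Fin N) (Fin N) ℂ) - φ b.src := by
  have hu : ∀ b' : PBond P j, ((B10Eq27TorusAxialLog.unitsField (B10Eq27TorusAxialLog.toUField U₀) b' : (Matrix (Fin N) (Fin N) ℂ)ˣ) :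
      Matrix (Fin N) (Fin N) ℂ) = (U₀ b' : Matrix (Fin N) (Fin N) ℂ) := fun _ => rfl
  have hui : ∀ b' : PBond P j, (((B10Eq27TorusAxialLog.unitsField (B10Eq27TorusAxialLog.toUField U₀) b')⁻¹ : (Matrix (Fin N) (Fin N) ℂ)ˣ) :
      Matrix (Fin N) (Fin N) ℂ) = star (U₀ b' : Matrix (Fin N) (Fin N) ℂ) := by
    intro b'
    rw [Prop7CovariantCoercivity.coe_inv_eq_star (B7Prop2Explicit.mem_unitaryUnits.mp (B10Eq27TorusAxialLog.unitsField_mem_unitaryUnits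
      (B10Eq27TorusAxialLog.toUField U₀) b')), hu]
  simp only [B9Eq39Adjoint.covD, B9Eq39Adjoint.R_def, B9TorusCalculus.torusT_apply, hu, hui]
  rfl

/-- ★ **THE COVARIANT N7-A IN HODGE-SPLIT FORM**: with `Y(b) = B(b) + (D_{U₀}φ)(b)` (the output of ✓ `Prop7CovHodgeSplit.exists_covHodgeSplit_T3`, `B := Y − D_{U₀}φ`
covariantly co-closed) the identity of §1 holds verbatim. [cite: Balaban1984PropagatorsI, (1.18)-(1.20) pp.19-20; Balaban1985BackgroundPropagators, (3.3) p.390] -/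
theorem covConstraint_on_hodge_parts_covD [NeZero N] (U₀ : GaugeField P 0 (Matrix.specialUnitaryGroup (Fin N) ℂ))
    (Q : (k : ℕ) → (PBond P 0 → Matrix (Fin N) (Fin N) ℂ) → PBond P k → Matrix (Fin N) (Fin N) ℂ) (hQ0 : ∀ Y, Q 0 Y = Y)
    (hQs : ∀ (k : ℕ) (Y : PBond P 0 → Matrix (Fin N) (Fin N) ℂ) (c : PBond P (k + 1)), Q (k + 1) Y c
      = fderiv ℂ (eml : (Idx P → Matrix (Fin N) (Fin N) ℂ) → Matrix (Fin N) (Fin N) ℂ)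
            (fun i => ((loopHol (Averaging.iter (fun i => blockAvg (P := P) (j := i) (expMeanLogSU (n := Fin N))) k U₀) c i :
              Matrix.specialUnitaryGroup (Fin N) ℂ) : Matrix (Fin N) (Fin N) ℂ))
            (fun i => covWalkSum (Averaging.iter (fun i => blockAvg (P := P) (j := i) (expMeanLogSU (n := Fin N))) k U₀) (Q k Y)
                (walk (emb c.src) (loopWord P.L c.dir (off i.1) i.2.1 i.2.2))
              * ((loopHol (Averaging.iter (fun i => blockAvg (P := P) (j := i) (expMeanLogSU (n := Fin N))) k U₀) c i :
                Matrix.specialUnitaryGroup (Fin N) ℂ) : Matrix (Fin N) (Fin N) ℂ))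
            * star ((corr (expMeanLogSU (n := Fin N)) (Averaging.iter (fun i => blockAvg (P := P) (j := i) (expMeanLogSU (n := Fin N))) k U₀) c :
                Matrix.specialUnitaryGroup (Fin N) ℂ) : Matrix (Fin N) (Fin N) ℂ)
          + ((corr (expMeanLogSU (n := Fin N)) (Averaging.iter (fun i => blockAvg (P := P) (j := i) (expMeanLogSU (n := Fin N))) k U₀) c :
                Matrix.specialUnitaryGroup (Fin N) ℂ) : Matrix (Fin N) (Fin N) ℂ)
            * covWalkSum (Averaging.iter (fun i => blockAvg (P := P) (j := i) (expMeanLogSU (n := Fin N))) k U₀) (Q k Y)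
                (walk (emb c.src) (List.replicate P.L (c.dir, true)))
            * star ((corr (expMeanLogSU (n := Fin N)) (Averaging.iter (fun i => blockAvg (P := P) (j := i) (expMeanLogSU (n := Fin N))) k U₀) c :
                Matrix.specialUnitaryGroup (Fin N) ℂ) : Matrix (Fin N) (Fin N) ℂ))
    (Y B : PBond P 0 → Matrix (Fin N) (Fin N) ℂ) (φ : Site P 0 → Matrix (Fin N) (Fin N) ℂ)
    (hY : ∀ b : PBond P 0, Y b = B b
        + B9Eq39Adjoint.covD (B9TorusCalculus.torusT P 0) (fun κ z => B10Eq27TorusAxialLog.unitsField (B10Eq27TorusAxialLog.toUField U₀) ⟨z, κ⟩) b.dir φ b.src)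
    (CM : (k : ℕ) → (PBond P k → Matrix (Fin N) (Fin N) ℂ) → Site P (k + 1) → Matrix (Fin N) (Fin N) ℂ)
    (G : (k : ℕ) → PBond P k → Matrix (Fin N) (Fin N) ℂ) (Λ : (k : ℕ) → Site P k → Matrix (Fin N) (Fin N) ℂ)
    (hG0 : ∀ b, G 0 b = B b) (hΛ0 : ∀ x, Λ 0 x = 0)
    (hΛs : ∀ (k : ℕ) (z : Site P (k + 1)), Λ (k + 1) z = CM k (G k) z + Λ k (emb z))
    (hGs : ∀ (k : ℕ) (c : PBond P (k + 1)), G (k + 1) c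
      = (fderiv ℂ (eml : (Idx P → Matrix (Fin N) (Fin N) ℂ) → Matrix (Fin N) (Fin N) ℂ)
            (fun i => ((loopHol (Averaging.iter (fun i => blockAvg (P := P) (j := i) (expMeanLogSU (n := Fin N))) k U₀) c i :
              Matrix.specialUnitaryGroup (Fin N) ℂ) : Matrix (Fin N) (Fin N) ℂ))
            (fun i => covWalkSum (Averaging.iter (fun i => blockAvg (P := P) (j := i) (expMeanLogSU (n := Fin N))) k U₀) (G k)
                (walk (emb c.src) (loopWord P.L c.dir (off i.1) i.2.1 i.2.2))
              * ((loopHol (Averaging.iter (fun i => blockAvg (P := P) (j := i) (expMeanLogSU (n := Fin N))) k U₀) c i :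
                Matrix.specialUnitaryGroup (Fin N) ℂ) : Matrix (Fin N) (Fin N) ℂ))
            * star ((corr (expMeanLogSU (n := Fin N)) (Averaging.iter (fun i => blockAvg (P := P) (j := i) (expMeanLogSU (n := Fin N))) k U₀) c :
                Matrix.specialUnitaryGroup (Fin N) ℂ) : Matrix (Fin N) (Fin N) ℂ)
          + ((corr (expMeanLogSU (n := Fin N)) (Averaging.iter (fun i => blockAvg (P := P) (j := i) (expMeanLogSU (n := Fin N))) k U₀) c :
                Matrix.specialUnitaryGroup (Fin N) ℂ) : Matrix (Fin N) (Fin N) ℂ)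
            * covWalkSum (Averaging.iter (fun i => blockAvg (P := P) (j := i) (expMeanLogSU (n := Fin N))) k U₀) (G k)
                (walk (emb c.src) (List.replicate P.L (c.dir, true)))
            * star ((corr (expMeanLogSU (n := Fin N)) (Averaging.iter (fun i => blockAvg (P := P) (j := i) (expMeanLogSU (n := Fin N))) k U₀) c :
                Matrix.specialUnitaryGroup (Fin N) ℂ) : Matrix (Fin N) (Fin N) ℂ))
        - (CM k (G k) c.src
            - ((Averaging.iter (fun i => blockAvg (P := P) (j := i) (expMeanLogSU (n := Fin N))) (k + 1) U₀ c : Matrix.specialUnitaryGroup (Fin N) ℂ) :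
                Matrix (Fin N) (Fin N) ℂ) * CM k (G k) c.tgt
              * star ((Averaging.iter (fun i => blockAvg (P := P) (j := i) (expMeanLogSU (n := Fin N))) (k + 1) U₀ c :
                Matrix.specialUnitaryGroup (Fin N) ℂ) : Matrix (Fin N) (Fin N) ℂ))) :
    ∀ k : ℕ, (∀ j < k, ∀ (c : PBond P (j + 1)) (i : Idx P),
        dist1 (loopHol (Averaging.iter (fun i => blockAvg (P := P) (j := i) (expMeanLogSU (n := Fin N))) j U₀) c i) < deltaSU (Fin N)) →
      ∀ c : PBond P k,
        G k c + ((Λ k c.src - φ (embIter k c.src))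
            - ((Averaging.iter (fun i => blockAvg (P := P) (j := i) (expMeanLogSU (n := Fin N))) k U₀ c : Matrix.specialUnitaryGroup (Fin N) ℂ) :
                Matrix (Fin N) (Fin N) ℂ)
              * (Λ k c.tgt - φ (embIter k c.tgt))
              * star ((Averaging.iter (fun i => blockAvg (P := P) (j := i) (expMeanLogSU (n := Fin N))) k U₀ c : Matrix.specialUnitaryGroup (Fin N) ℂ) :
                  Matrix (Fin N) (Fin N) ℂ))
          = Q k Y c := by
  have hY' : ∀ b : PBond P 0, Y b = B b - (φ b.src - ((U₀ b : Matrix.specialUnitaryGroup (Fin N) ℂ) : Matrix (Fin N) (Fin N) ℂ) * φ b.tgt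
      * star ((U₀ b : Matrix.specialUnitaryGroup (Fin N) ℂ) : Matrix (Fin N) (Fin N) ℂ)) := fun b => by
    rw [hY b, covD_bg_apply U₀ φ b]
    abel
  exact covConstraint_on_hodge_parts U₀ Q hQ0 hQs Y B φ hY' CM G Λ hG0 hΛ0 hΛs hGs

end Units

end Summit.QuantumFields.YangMills.Theorems.Prop7CovHodgeConstraint

end
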